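/-
Origin: expansion seat `planner-pub-hodgecm-pv10-g5-0`, handover #6(4/6) 2026-08-18T15:21:38Z (supersedes #4 666e7e03) ; rewrite: ^import Pv10g5\.QuotientFunctions -> import HodgeCM.PerL34.QuotientFunctions ; ^import Pv10g5\.BallHolomorphic -> import HodgeCM.PerL34.BallHolomorphic (`HOME/pub-hodgecm-pv10-g5/lean/Pv10g5/BallQuotientFunctions.lean`, md5 affe76b0, 228 lines);
landed by the gen-8 packager in gate run 31 as `HodgeCM/PerL34/BallQuotientFunctions.lean` (import ^import Pv10g5\.BallHolomorphic[ \t]*$→import HodgeCM.PerL34.BallHolomorphic ×1; import ^import Pv10g5\.QuotientFunctions[ \t]*$→import HodgeCM.PerL34.QuotientFunctions ×1; stripped 5 #print/#check/#eval lines).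
-/
/-
Origin: pub-hodgecm speedrun cell, seat pv10-g5 (DAG-NODE PROVER #10, gen 5), 2026-08-18.  STAGING for the tree import
(LEAN-IN-TREE RULE 2026-08-18): tree-shaped (≤ 400 lines, docstring on every decl, general engine and ball/PerL
specialisation in separate files); see `HOME/pub-hodgecm-pv10-g5/MODULE-MAP-pv10.md`.
Target path: `HodgeCM/PerL34/BallQuotientFunctions.lean`.  Proposed tree home: with the PerL ball-piece files under
`Summits/HodgeConjecture/PerL/…`.
WIP imports `Pv10g5.QuotientFunctions` ↦ `HodgeCM.PerL34.QuotientFunctions` and `Pv10g5.BallHolomorphic` ↦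
`HodgeCM.PerL34.BallHolomorphic` at landing (TWO rewrites).  KERNEL, nothing cited, nothing posited.
-/
import Summits.HodgeConjecture.HodgeCM.PerL34.QuotientFunctions
import Summits.HodgeConjecture.HodgeCM.PerL34.BallHolomorphic

/-!
# Holomorphic functions on `𝔹²` and on `Γ\𝔹²`; `H⁰(P^L_Γ, 𝒪) = ℂ` for compact pieces

Ball (ns `HodgeCM.PerL34.BallComplex`): the manifold notions on `𝔹² ⊂ ℂ²` ARE the classical ones —
`ContMDiff 𝓘(ℂ,ℂ²) 𝓘(ℂ,F) n f ↔ ContDiffOn ℂ n (f ∘ ballChart.symm) ballSet` and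
`MDifferentiable … f ↔ DifferentiableOn ℂ (f ∘ ballChart.symm) ballSet` (`contMDiff_ball_iff`,
`mdifferentiable_ball_iff`); and **Liouville on compact ball quotients**: if `Γ\𝔹²` is compact, every holomorphic
function `Γ\𝔹² → F` is constant (`hol_apply_eq_of_compactSpace`, Mathlib's maximum-modulus theorem on compact
connected complex manifolds + `pathConnectedSpace_ballQuotient`), so every `Γ`-invariant holomorphic function on the
ball is constant (`invariant_hol_const`: stated CLASSICALLY, for `F : ℂ² → F'` differentiable on the open ball and
invariant under the Möbius action of `Γ`).

PerL (ns `HodgeCM.PerL34.ArchCompactK`): for `[L:ℚ] ≠ 2` every piece `Γ_H(bK_fb⁻¹)'\𝔹²` is compact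
(`HermSpace3.compactSpace_ballPiece`, from the tree's `compactSpace_piece` + `pieceHomeomorphBall`), so for compact
open `K_f ≤ K_H(3)`: `H⁰(P^L_{Γ,b}, 𝒪) = ℂ` — every holomorphic function on the piece, equivalently every
`Γ_H(bK_fb⁻¹)'`-invariant holomorphic function on `𝔹²`, is constant (`HermSpace3.ballPiece_hol_const`,
`HermSpace3.ballPiece_invariant_hol_const`).  (The `p = 0` case of PerL §3.1's "forms on `S(K_f)` = automorphic
forms"; the cases `p = 1, 2` and (eq:Qaut) are PRINT — Matsushima, [BW VII].)
General descent (`f : G\M → N` is `C^n` iff `f ∘ π` is) is the engine file `QuotientFunctions`.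
`#print axioms` of every result = `[propext, Classical.choice, Quot.sound]`.
-/

noncomputable section

open scoped Matrix Pointwise Manifold ContDiff Topology
open MulAction Set

/-! ## The ball: manifold regularity on `𝔹²` is classical regularity on the open ball of `ℂ²` -/

namespace HodgeCM.PerL34.BallComplex

open HodgeCM.PerL34.BallModel HodgeCM.PerL34.QuotientManifold

variable {F' : Type*} [NormedAddCommGroup F'] [NormedSpace ℂ F']

/-- The inclusion `𝔹² → ℂ²` is `C^n` (Mathlib's `contMDiff_isOpenEmbedding` for our singleton charted space). -/
theorem contMDiff_ballInclusion (n : WithTop ℕ∞) : ContMDiff 𝓘(ℂ, Fin 2 → ℂ) 𝓘(ℂ, Fin 2 → ℂ) n inclusion :=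
  contMDiff_isOpenEmbedding (I := 𝓘(ℂ, Fin 2 → ℂ)) isOpenEmbedding_inclusion

/-- `ballChart.symm : ℂ² ⊇ ballSet → 𝔹²` is `C^n` on the ball. -/
theorem contMDiffOn_ballChart_symm (n : WithTop ℕ∞) :
    ContMDiffOn 𝓘(ℂ, Fin 2 → ℂ) 𝓘(ℂ, Fin 2 → ℂ) n ballChart.symm ballSet := by
  have h := contMDiffOn_isOpenEmbedding_symm (I := 𝓘(ℂ, Fin 2 → ℂ)) (n := n) isOpenEmbedding_inclusion
  rwa [range_inclusion] at h

/-- **Manifold-`C^n` on `𝔹²` = classical `C^n` on the open ball**: for `f : 𝔹² → F'`,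
`ContMDiff 𝓘(ℂ,ℂ²) 𝓘(ℂ,F') n f ↔ ContDiffOn ℂ n (f ∘ ballChart.symm) ballSet`. -/
theorem contMDiff_ball_iff (n : WithTop ℕ∞) (f : Ball → F') :
    ContMDiff 𝓘(ℂ, Fin 2 → ℂ) 𝓘(ℂ, F') n f ↔ ContDiffOn ℂ n (f ∘ ballChart.symm) ballSet := by
  rw [← contMDiffOn_iff_contDiffOn]
  constructor
  · intro hf
    exact hf.comp_contMDiffOn (contMDiffOn_ballChart_symm n)
  · intro h
    have : f = (f ∘ ballChart.symm) ∘ inclusion := by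
      funext z
      simp only [Function.comp_apply, inclusion, ballChart_symm_apply z.2, Subtype.coe_eta]
    rw [this]
    exact h.comp_contMDiff (contMDiff_ballInclusion n) fun z => z.2

/-- **Manifold-differentiable on `𝔹²` = classically differentiable on the open ball.** -/
theorem mdifferentiable_ball_iff (f : Ball → F') :
    MDifferentiable 𝓘(ℂ, Fin 2 → ℂ) 𝓘(ℂ, F') f ↔ DifferentiableOn ℂ (f ∘ ballChart.symm) ballSet := by
  rw [← mdifferentiableOn_iff_differentiableOn]
  constructor
  · intro hf
    exact hf.comp_mdifferentiableOn ((contMDiffOn_ballChart_symm 1).mdifferentiableOn one_ne_zero)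
  · intro h
    have : f = (f ∘ ballChart.symm) ∘ inclusion := by
      funext z
      simp only [Function.comp_apply, inclusion, ballChart_symm_apply z.2, Subtype.coe_eta]
    rw [this]
    intro z
    exact (h.mdifferentiableAt (ballSet_isOpen.mem_nhds z.2)).comp z
      (((contMDiff_ballInclusion 1).mdifferentiable one_ne_zero) z)

/-! ### Functions on `Γ\𝔹²` -/

/-- **Holomorphic functions on `Γ\𝔹²` = `Γ`-invariant holomorphic functions on `𝔹²`** (`f ↔ f ∘ π`). -/
theorem contMDiff_comp_ballQuotientMk_iff (Γ : Subgroup U21) [DiscreteTopology Γ] [IsCancelSMul Γ Ball]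
    {f : orbitRel.Quotient Γ Ball → F'} :
    ContMDiff 𝓘(ℂ, Fin 2 → ℂ) 𝓘(ℂ, F') ω (f ∘ Quotient.mk (orbitRel Γ Ball)) ↔
      ContMDiff 𝓘(ℂ, Fin 2 → ℂ) 𝓘(ℂ, F') ω f :=
  contMDiff_comp_mk_iff (actsBy_ball Γ)

/-- DESCENT on the ball, differentiable version: `f : Γ\𝔹² → F'` is (manifold-)differentiable iff `f ∘ π` is. -/
theorem mdifferentiable_comp_ballQuotientMk_iff (Γ : Subgroup U21) [DiscreteTopology Γ] [IsCancelSMul Γ Ball]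
    {f : orbitRel.Quotient Γ Ball → F'} :
    MDifferentiable 𝓘(ℂ, Fin 2 → ℂ) 𝓘(ℂ, F') (f ∘ Quotient.mk (orbitRel Γ Ball)) ↔
      MDifferentiable 𝓘(ℂ, Fin 2 → ℂ) 𝓘(ℂ, F') f :=
  mdifferentiable_comp_mk_iff (n := ω) (actsBy_ball Γ) (by simp)

/-- A holomorphic (`MDifferentiable`) function on `Γ\𝔹²`, read on the open ball of `ℂ²`, is a `Γ`-invariant
classically differentiable function. -/
theorem differentiableOn_comp_of_mdifferentiable (Γ : Subgroup U21) [DiscreteTopology Γ]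
    [IsCancelSMul Γ Ball] {f : orbitRel.Quotient Γ Ball → F'}
    (hf : MDifferentiable 𝓘(ℂ, Fin 2 → ℂ) 𝓘(ℂ, F') f) :
    DifferentiableOn ℂ (f ∘ Quotient.mk (orbitRel Γ Ball) ∘ ballChart.symm) ballSet ∧
      ∀ γ : Γ, ∀ x ∈ ballSet, (f ∘ Quotient.mk (orbitRel Γ Ball) ∘ ballChart.symm) (moebius γ x) =
        (f ∘ Quotient.mk (orbitRel Γ Ball) ∘ ballChart.symm) x := by
  refine ⟨(mdifferentiable_ball_iff _).mp ((mdifferentiable_comp_ballQuotientMk_iff Γ).mpr hf), ?_⟩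
  intro γ x hx
  have hγx : moebius γ x ∈ ballSet := by
    have h := (γ • ballChart.symm x).2
    rw [Subgroup.smul_def, val_smul, ballChart_symm_apply hx] at h
    exact h
  have hz : (⟨moebius γ x, hγx⟩ : Ball) = γ • ballChart.symm x := by
    apply Subtype.ext
    rw [Subgroup.smul_def, val_smul, ballChart_symm_apply hx]
  simp only [Function.comp_apply]
  rw [ballChart_symm_apply hγx, ballChart_symm_apply hx, hz, ballChart_symm_apply hx]
  exact congrArg f (Quotient.sound (mem_orbit _ γ))

/-! ### Liouville: holomorphic functions on a COMPACT `Γ\𝔹²` are constant -/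

/-- **Every holomorphic function on a compact `Γ\𝔹²` is constant** (`Γ ≤ U(2,1)` discrete and free; the
quotient is connected by `pathConnectedSpace_ballQuotient`; Mathlib's maximum modulus principle on compact
complex manifolds). -/
theorem hol_apply_eq_of_compactSpace (Γ : Subgroup U21) [DiscreteTopology Γ] [IsCancelSMul Γ Ball]
    [CompactSpace (orbitRel.Quotient Γ Ball)] {f : orbitRel.Quotient Γ Ball → F'}
    (hf : MDifferentiable 𝓘(ℂ, Fin 2 → ℂ) 𝓘(ℂ, F') f) (a b : orbitRel.Quotient Γ Ball) : f a = f b :=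
  haveI := isManifold_ballQuotient Γ
  hf.apply_eq_of_compactSpace a b

/-- **A `Γ`-invariant holomorphic function on the ball is constant when `Γ\𝔹²` is compact** — classical form:
`F : ℂ² → F'` differentiable on the open unit ball and invariant under the Möbius action of `Γ`. -/
theorem invariant_hol_const (Γ : Subgroup U21) [DiscreteTopology Γ] [IsCancelSMul Γ Ball]
    [CompactSpace (orbitRel.Quotient Γ Ball)] (F : (Fin 2 → ℂ) → F') (hF : DifferentiableOn ℂ F ballSet)
    (hinv : ∀ γ : Γ, ∀ x ∈ ballSet, F (moebius γ x) = F x) {x y : Fin 2 → ℂ} (hx : x ∈ ballSet)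
    (hy : y ∈ ballSet) : F x = F y := by
  -- the invariant function `F ∘ inclusion` descends to `Γ\𝔹²`
  let Fi : {F : Ball → F' // ∀ g : Γ, ∀ z : Ball, F (g • z) = F z} :=
    ⟨F ∘ inclusion, fun γ z => by
      change F (γ • z).1 = F z.1
      rw [Subgroup.smul_def, val_smul]
      exact hinv γ z.1 z.2⟩
  have hFi : MDifferentiable 𝓘(ℂ, Fin 2 → ℂ) 𝓘(ℂ, F') Fi.1 := by
    rw [mdifferentiable_ball_iff]
    refine hF.congr fun z hz => ?_
    simp only [Fi, Function.comp_apply, inclusion, ballChart_symm_apply hz]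
  have hf : MDifferentiable 𝓘(ℂ, Fin 2 → ℂ) 𝓘(ℂ, F') (invariantEquiv Γ Ball F' Fi) :=
    (mdifferentiable_invariantEquiv_iff (n := ω) (actsBy_ball Γ) (by simp) Fi).mpr hFi
  have h := hol_apply_eq_of_compactSpace Γ hf (Quotient.mk _ ⟨x, hx⟩) (Quotient.mk _ ⟨y, hy⟩)
  simpa [Fi, inclusion] using h

end HodgeCM.PerL34.BallComplex

/-! ## PerL: `H⁰(P^L_{Γ,b}, 𝒪) = ℂ` on every piece (`[L:ℚ] ≠ 2`, `K_f ≤ K_H(3)` compact open) -/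

namespace HodgeCM.PerL34.ArchCompactK

section PerLBall

open HodgeCM.PerL34.Godement HodgeCM.PerL34.Godement.Stages HodgeCM.PerL34.AdelicUnitaryFactorisation
open HodgeCM.PerL34.BallComplex HodgeCM.PerL34.QuotientManifold
open Literature.AlgebraicGeometry.ShimuraVarieties (signatureMatrix)
open HodgeCM.PerL34.BallModel (U21 Ball x₀)
open NumberField

variable (L : CMField) {ι₁ : L →+* ℂ} (V : HermSpace3 L ι₁) {T : GL (Fin 3) ℂ}
  (hT : (T : Matrix (Fin 3) (Fin 3) ℂ)ᴴ * V.Hm.map (InfinitePlace.mk ι₁).embedding *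
    (T : Matrix (Fin 3) (Fin 3) ℂ) = signatureMatrix 2)

include hT

/-- Every piece `Γ_H(bK_fb⁻¹)'\𝔹²` is COMPACT (`[L:ℚ] ≠ 2`, `K_f` open; tree: `compactSpace_piece`,
`pieceHomeomorphBall`). -/
theorem _root_.HodgeCM.HermSpace3.compactSpace_ballPiece (hL : Module.finrank ℚ L ≠ 2)
    (Kf : Subgroup (Ufin L V.Hm)) (hKo : IsOpen (Kf : Set (Ufin L V.Hm))) (b : Ufin L V.Hm) :
    CompactSpace (orbitRel.Quotient ((congruenceLattice L V.Hm (MulAut.conj b • Kf)).map (V.archToU21 hT))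
      Ball) := by
  haveI := compactSpace_piece L V hL Kf hKo T b
  exact (V.pieceHomeomorphBall hT _).compactSpace

variable {F' : Type*} [NormedAddCommGroup F'] [NormedSpace ℂ F']

/-- **`H⁰(P^L_{Γ,b}, 𝒪) = ℂ`**: every holomorphic function on the compact connected complex surface
`Γ_H(bK_fb⁻¹)'\𝔹²` (`[L:ℚ] ≠ 2`, `K_f ≤ K_H(3)` compact open; structure `HermSpace3.isManifold_ballPiece`)
is constant. -/
theorem _root_.HodgeCM.HermSpace3.ballPiece_hol_const (hL : Module.finrank ℚ L ≠ 2)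
    (Kf : Subgroup (Ufin L V.Hm)) (hKo : IsOpen (Kf : Set (Ufin L V.Hm))) (hKc : IsCompact (Kf : Set (Ufin L V.Hm)))
    (hK3 : Kf ≤ levelUfin L V.Hm 3) (b : Ufin L V.Hm) :
    haveI := discreteTopology_pieceLattice L V hT Kf hKc b
    haveI := isCancelSMul_pieceLattice L V hT Kf hKc hK3 b
    ∀ f : orbitRel.Quotient ((congruenceLattice L V.Hm (MulAut.conj b • Kf)).map (V.archToU21 hT)) Ball → F',
      MDifferentiable 𝓘(ℂ, Fin 2 → ℂ) 𝓘(ℂ, F') f → ∀ a c, f a = f c := by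
  intro f hf a c
  haveI := discreteTopology_pieceLattice L V hT Kf hKc b
  haveI := isCancelSMul_pieceLattice L V hT Kf hKc hK3 b
  haveI := HodgeCM.HermSpace3.compactSpace_ballPiece L V hT hL Kf hKo b
  exact hol_apply_eq_of_compactSpace _ hf a c

/-- **Weight-zero automorphic functions are constant**: a holomorphic function on the open unit ball of `ℂ²`
invariant under the Möbius action of `Γ_H(bK_fb⁻¹)' ≤ U(2,1)` is constant (`[L:ℚ] ≠ 2`, `K_f ≤ K_H(3)` compact
open). -/
theorem _root_.HodgeCM.HermSpace3.ballPiece_invariant_hol_const (hL : Module.finrank ℚ L ≠ 2)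
    (Kf : Subgroup (Ufin L V.Hm)) (hKo : IsOpen (Kf : Set (Ufin L V.Hm))) (hKc : IsCompact (Kf : Set (Ufin L V.Hm)))
    (hK3 : Kf ≤ levelUfin L V.Hm 3) (b : Ufin L V.Hm) (F : (Fin 2 → ℂ) → F')
    (hF : DifferentiableOn ℂ F BallComplex.ballSet)
    (hinv : ∀ γ ∈ (congruenceLattice L V.Hm (MulAut.conj b • Kf)).map (V.archToU21 hT),
      ∀ x ∈ BallComplex.ballSet, F (moebius γ x) = F x)
    {x y : Fin 2 → ℂ} (hx : x ∈ BallComplex.ballSet) (hy : y ∈ BallComplex.ballSet) : F x = F y := by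
  haveI := discreteTopology_pieceLattice L V hT Kf hKc b
  haveI := isCancelSMul_pieceLattice L V hT Kf hKc hK3 b
  haveI := HodgeCM.HermSpace3.compactSpace_ballPiece L V hT hL Kf hKo b
  exact invariant_hol_const _ F hF (fun γ x hx => hinv γ.1 γ.2 x hx) hx hy

end PerLBall

end HodgeCM.PerL34.ArchCompactK

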